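import Mathlib.Algebra.BigOperators.Intervals
import Literature.Computability.AlgebraicComplexity.CwSquareGenericTables
import HarnessLib

/-!
# Counting the pivot rows of the uniform `p = 1` flattening of `T_{cw,q}^{⊠2}`: `2(q+2)²`

Topic: `Literature/Computability/AlgebraicComplexity`. Step F4a of the general case of the square part
of Conner–Gesmundo–Landsberg–Ventura 2022, Thm. 1.2 (`CwSquareGenericTables.lean`): the number of
pivot rows (rows `r` with `rowInfo r ≠ none`) at level `q ≥ 5` is exactly `2(q+2)²`, by sorting the
rows by shape — `98` pivot shapes with two special indices, `15 + 13` with one generic index,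
`2` diagonal and `2` off-diagonal generic shapes:
`98 + 28(q-5) + 2(q-5) + 2(q-5)(q-6) = 2(q+2)²`. Everything here is **proved**:

* `CwSqGen.PivRow q` — the type of pivot rows; `CwSqGen.card_pivRow : |PivRow q| = 2(q+2)²`
  (`q ≥ 5`).

## References

* A. Conner, F. Gesmundo, J. M. Landsberg, E. Ventura, *Rank and border rank of Kronecker powers of
  tensors and Strassen's laser method*, comput. complexity 31 (2022), arXiv:1909.04785, Thm. 1.2, §4.3
  (the rank `2(q+2)²`). [ConnerGesmundoLandsbergVentura2022]
-/

open scoped BigOperators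
open Finset

namespace Literature.Computability.AlgebraicComplexity

namespace CwSqGen

variable {q : ℕ}

/-- The type of pivot rows at level `q`. (A plain `def`, so that no order structure is inherited;
the rank file puts the peeling order on it.) [folklore] -/
def PivRow (q : ℕ) : Type := {r : Row q // (rowInfo r).isSome = true}

/-- Pivot rows form a finite type (the subtype structure). [folklore] -/
instance : Fintype (PivRow q) := inferInstanceAs (Fintype {r : Row q // (rowInfo r).isSome = true})

/-- Pivot rows have decidable equality (the subtype structure). [folklore] -/
instance : DecidableEq (PivRow q) :=
  inferInstanceAs (DecidableEq {r : Row q // (rowInfo r).isSome = true})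

/-- The indicator of pivot shapes as a function of raw index values. [folklore] -/
def gInd (t : Fin 3) (x₁ x₂ : ℕ) : ℕ :=
  if (rowTab t (clsNat x₁) (clsNat x₂) (eqFlag x₁ x₂)).isSome = true then 1 else 0

/-- Being a pivot row depends only on the table entry of the shape. [folklore] -/
theorem isSome_rowInfo_iff (r : Row q) :
    (rowInfo r).isSome = true ↔
      (rowTab r.1 (clsNat r.2.1.val) (clsNat r.2.2.val) (eqFlag r.2.1.val r.2.2.val)).isSome = true := by
  unfold rowInfo
  cases rowTab r.1 (clsNat r.2.1.val) (clsNat r.2.2.val) (eqFlag r.2.1.val r.2.2.val) with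
  | none => simp
  | some v => obtain ⟨i, k, s, p₁, p₂⟩ := v; simp

/-- The number of pivot rows as a triple sum of the shape indicator. [folklore] -/
theorem card_pivRow_eq_sum :
    Fintype.card (PivRow q) =
      ∑ t : Fin 3, ∑ x₁ ∈ range (q + 1), ∑ x₂ ∈ range (q + 1), gInd t x₁ x₂ := by
  unfold PivRow
  rw [Fintype.card_subtype, Finset.card_filter, Fintype.sum_prod_type, Finset.sum_congr rfl]
  intro t _
  rw [Fintype.sum_prod_type]
  rw [← Fin.sum_univ_eq_sum_range (fun x₁ => ∑ x₂ ∈ range (q + 1), gInd t x₁ x₂) (q + 1)]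
  refine Finset.sum_congr rfl fun x₁ _ => ?_
  rw [← Fin.sum_univ_eq_sum_range (fun x₂ => gInd t x₁ x₂) (q + 1)]
  refine Finset.sum_congr rfl fun x₂ _ => ?_
  unfold gInd
  exact if_congr (isSome_rowInfo_iff (t, (x₁, x₂))) rfl rfl

/-! ## The indicator on the four blocks -/

/-- Generic values have class `6`. [folklore] -/
theorem clsNat_of_le {x : ℕ} (hx : 6 ≤ x) : clsNat x = 6 := by
  unfold clsNat
  rw [dif_neg (not_lt.2 hx)]

/-- A special first index has equality flag `0`. [folklore] -/
theorem eqFlag_of_lt_left {a : ℕ} (ha : a < 6) (y : ℕ) : eqFlag a y = 0 := by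
  unfold eqFlag
  rw [if_neg]
  omega

/-- A special second index (with generic first index) has equality flag `0`. [folklore] -/
theorem eqFlag_of_lt_right {x b : ℕ} (hx : 6 ≤ x) (hb : b < 6) : eqFlag x b = 0 := by
  unfold eqFlag
  rw [if_neg]
  omega

/-- For a generic first index the flag records equality. [folklore] -/
theorem eqFlag_of_le {x : ℕ} (hx : 6 ≤ x) (y : ℕ) : eqFlag x y = if x = y then 1 else 0 := by
  unfold eqFlag
  by_cases h : x = y
  · rw [if_pos ⟨hx, h⟩, if_pos h]
  · rw [if_neg (fun h' => h h'.2), if_neg h]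

/-- Special first index, generic second index. [folklore] -/
theorem gInd_sg (t : Fin 3) {a x : ℕ} (ha : a < 6) (hx : 6 ≤ x) : gInd t a x = gInd t a 6 := by
  unfold gInd
  rw [clsNat_of_le hx, clsNat_of_le le_rfl, eqFlag_of_lt_left ha, eqFlag_of_lt_left ha]

/-- Generic first index, special second index. [folklore] -/
theorem gInd_gs (t : Fin 3) {x b : ℕ} (hx : 6 ≤ x) (hb : b < 6) : gInd t x b = gInd t 6 b := by
  unfold gInd
  rw [clsNat_of_le hx, clsNat_of_le le_rfl, eqFlag_of_lt_right hx hb, eqFlag_of_lt_right le_rfl hb]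

/-- Two generic indices: only equality matters. [folklore] -/
theorem gInd_gg (t : Fin 3) {x y : ℕ} (hx : 6 ≤ x) (hy : 6 ≤ y) :
    gInd t x y = if y = x then gInd t 6 6 else gInd t 6 7 := by
  unfold gInd
  rw [clsNat_of_le hx, clsNat_of_le hy, clsNat_of_le le_rfl, clsNat_of_le (by norm_num : 6 ≤ 7),
    eqFlag_of_le hx, eqFlag_of_le le_rfl, eqFlag_of_le le_rfl]
  by_cases h : y = x
  · subst h
    simp
  · have h' : ¬ x = y := fun e => h e.symm
    simp [h, h']

/-! ## Splitting the double sum -/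

/-- `range (q+1) = Ico 0 6 ∪ Ico 6 (q+1)` for sums (`q ≥ 5`). [folklore] -/
theorem sum_range_split (hq : 5 ≤ q) (f : ℕ → ℕ) :
    ∑ x ∈ range (q + 1), f x = (∑ x ∈ range 6, f x) + ∑ x ∈ Ico 6 (q + 1), f x := by
  rw [Finset.range_eq_Ico, Finset.range_eq_Ico, Finset.sum_Ico_consecutive f (by omega) (by omega)]

/-- The inner sum for a special first index. [folklore] -/
theorem sum_gInd_special (hq : 5 ≤ q) (t : Fin 3) {a : ℕ} (ha : a < 6) :
    ∑ x₂ ∈ range (q + 1), gInd t a x₂ = (∑ b ∈ range 6, gInd t a b) + (q - 5) * gInd t a 6 := by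
  rw [sum_range_split hq]
  congr 1
  rw [Finset.sum_const_nat (m := gInd t a 6) fun x hx => gInd_sg t ha (Finset.mem_Ico.1 hx).1,
    Nat.card_Ico]
  congr 1

/-- The inner sum for a generic first index. [folklore] -/
theorem sum_gInd_generic (hq : 5 ≤ q) (t : Fin 3) {x : ℕ} (hx : x ∈ Ico 6 (q + 1)) :
    ∑ x₂ ∈ range (q + 1), gInd t x x₂ =
      (∑ b ∈ range 6, gInd t 6 b) + (gInd t 6 6 + (q - 6) * gInd t 6 7) := by
  have hx6 : 6 ≤ x := (Finset.mem_Ico.1 hx).1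
  rw [sum_range_split hq]
  congr 1
  · exact Finset.sum_congr rfl fun b hb => gInd_gs t hx6 (Finset.mem_range.1 hb)
  · rw [Finset.sum_congr rfl fun y hy => gInd_gg t hx6 (Finset.mem_Ico.1 hy).1,
      ← Finset.add_sum_erase _ _ hx, if_pos rfl]
    congr 1
    rw [Finset.sum_const_nat (m := gInd t 6 7) fun y hy => by
        rw [if_neg (Finset.ne_of_mem_erase hy)],
      Finset.card_erase_of_mem hx, Nat.card_Ico]
    congr 1

/-- **The double sum, split by shapes.** [folklore] -/
theorem sum_gInd (hq : 5 ≤ q) (t : Fin 3) :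
    ∑ x₁ ∈ range (q + 1), ∑ x₂ ∈ range (q + 1), gInd t x₁ x₂ =
      (∑ a ∈ range 6, ∑ b ∈ range 6, gInd t a b) + (q - 5) * (∑ a ∈ range 6, gInd t a 6) +
        (q - 5) * ((∑ b ∈ range 6, gInd t 6 b) + (gInd t 6 6 + (q - 6) * gInd t 6 7)) := by
  rw [sum_range_split hq]
  have h1 : ∑ x₁ ∈ range 6, ∑ x₂ ∈ range (q + 1), gInd t x₁ x₂ =
      (∑ a ∈ range 6, ∑ b ∈ range 6, gInd t a b) + (q - 5) * ∑ a ∈ range 6, gInd t a 6 := by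
    rw [Finset.mul_sum, ← Finset.sum_add_distrib]
    exact Finset.sum_congr rfl fun a ha => sum_gInd_special hq t (Finset.mem_range.1 ha)
  have h2 : ∑ x₁ ∈ Ico 6 (q + 1), ∑ x₂ ∈ range (q + 1), gInd t x₁ x₂ =
      (q - 5) * ((∑ b ∈ range 6, gInd t 6 b) + (gInd t 6 6 + (q - 6) * gInd t 6 7)) := by
    rw [Finset.sum_const_nat fun x hx => sum_gInd_generic hq t hx, Nat.card_Ico]
    congr 1
  rw [h1, h2]

/-- The four shape counts of the table. [folklore] -/
theorem table_counts :
    (∑ t : Fin 3, ∑ a ∈ range 6, ∑ b ∈ range 6, gInd t a b) = 98 ∧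
    (∑ t : Fin 3, ∑ a ∈ range 6, gInd t a 6) = 15 ∧
    (∑ t : Fin 3, ∑ b ∈ range 6, gInd t 6 b) = 13 ∧
    (∑ t : Fin 3, gInd t 6 6) = 2 ∧ (∑ t : Fin 3, gInd t 6 7) = 2 := by
  refine ⟨?_, ?_, ?_, ?_, ?_⟩ <;> decide

/-- **The number of pivot rows is `2(q+2)²`** (`q ≥ 5`).
[cite: ConnerGesmundoLandsbergVentura2022, Thm. 1.2] -/
theorem card_pivRow (hq : 5 ≤ q) : Fintype.card (PivRow q) = 2 * (q + 2) ^ 2 := by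
  rw [card_pivRow_eq_sum, Finset.sum_congr rfl fun t _ => sum_gInd hq t]
  simp only [Finset.sum_add_distrib, ← Finset.mul_sum, mul_add]
  obtain ⟨h0, h1, h2, h3, h4⟩ := table_counts
  rw [h0, h1, h2, h3, h4]
  obtain ⟨m, rfl⟩ : ∃ m, q = m + 5 := ⟨q - 5, by omega⟩
  rw [show m + 5 - 5 = m by omega, show m + 5 - 6 = m - 1 by omega]
  rcases m with _ | m
  · norm_num
  · rw [show m + 1 - 1 = m by omega]
    ring

end CwSqGen

end Literature.Computability.AlgebraicComplexity
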